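import Literature.NumberTheory.EllipticCurves.TateUniformisation
import Literature.NumberTheory.EllipticCurves.TateModuleTwistTransportProofs
import Literature.NumberTheory.EllipticCurves.QuadraticTwistTateFormProofs
import Literature.NumberTheory.EllipticCurves.QuadraticTwistPadicReduction
import Literature.NumberTheory.EllipticCurves.ShaRestriction
import HarnessLib

/-!
# Tate's `v`-adic uniformisation under the PRINTED hypothesis `|j(E)|_v > 1` — derived in the
# kernel from the vendored multiplicative-reduction form A41 by the quadratic-twist transport
(team n1011, row T-A41J, seat p12 GEN 10; = FILE S of row T-VIS3-TATE in THEOREM form)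

HONEST FRAMING (cell `b2b-bsdres`, run/shared/lean/b2b/bsd-rank1-residual/, verbatim in every
file): the goal of the cell is to DELETE the COMBINATION-SHAPED residual classes of the
Birch–Swinnerton-Dyer formula for ALL analytic-rank `≤ 1` elliptic curves over `ℚ` — "full BSD
formula for every rank `≤ 1` curve in class `C`" assembled STRICTLY from published theorems — so
that the rank-`≤ 1` remainder becomes exactly the CONSTRUCTION-SHAPED classes, which are TYPED
(missing-input `Prop`s), NOT attempted. This is not "finishing BSD". Team n1011 (N10/N11; row
T-A41J, skeleton `cells/n1011/skel/T-A41J.md`): research routes on CONSTRUCTION-SHAPED classes;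
prove what is provable now; no claim beyond stated classes; census output = EVIDENCE, never a
Literature fact; RESIDUAL-MAP marks UNCHANGED; nothing is booked by this file. TOOL THEOREMS ONLY:
no definition, no new named fact. The ONLY named fact is the registered PUBLISHED A41
`Silverman1994_thmV53_corV54_tateUniformisation` (hypothesis `hU`).

## What

A41 transcribes Silverman, *ATAEC*, Thm. V.5.3 with Lemma V.5.2 (c) and Cor. V.5.4 (the TWISTED
Tate parametrisation `Ψ : K̄_v^* → E(K̄_v)`, kernel `q^ℤ`, `σ • Ψ(u) = χ(σ) Ψ(σu)`,
`χ(σ) = σ(t)/t`, `t² = −c₄/c₆`, and the description of `E(K_v)`) at a place of MULTIPLICATIVE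
reduction ("TODO(general form): V.5.3 assumes only `|j(E)|_v > 1`"). This file DERIVES the
general form — hypothesis `1 < v.valuation K W.j` (`ord_v j < 0`: also the ADDITIVE potentially
multiplicative places) — from A41 with the SAME eight conjuncts
(`tateUniformisation_of_one_lt_valuation_j`), by *AEC* X.5 Cor. 5.4: a twist `E^{(d)}` is
multiplicative at `v` (`exists_hasMultiplicativeReductionAt_quadraticTwist_of_one_lt_valuation_j`),
A41 uniformises it by `(q, t_d, Ψ_d)`, and the signed isomorphism `f : E^{(d)}(K̄_v) ≃+ E(K̄_v)`,
`f(σP) = (σ√d/√d) σ f(P)` (§1–§2: the tree's `exists_addEquiv_geomPoints_quadraticTwist_signed`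
with its sign NAMED, on the local points of a curve over a number field) gives `Ψ := f ∘ Ψ_d`,
`t := t_d √d`, `χ_t = χ_{t_d} χ_{√d}`. Conjunct (4) (Cor. V.5.4) is DERIVED from (1)–(3) for
ANY such datum (§3: `u` is algebraic over `K_v`, while `σ^k u = u q^{kn}`). No definition.

References: [SilvermanATAEC1994] J. H. Silverman, *ATAEC*, GTM 151, Ch. V Lemma 5.2 (c),
Thm. 5.3, Cor. 5.4 (held copy PDF pp. 406–410); [SilvermanAEC2009] J. H. Silverman, *AEC* 2nd
ed., X.2 Prop. 2.4, X.5 Cor. 5.4; cells/n1011/skel/T-A41J.md.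
-/

noncomputable section

open scoped Classical

open NumberField IsDedekindDomain Field

universe u

namespace Summit.BirchSwinnertonDyer.Rank1Residual.AdditivePotMult.TateOfValuationJ

open Literature.NumberTheory.EllipticCurves Literature.NumberTheory.GaloisRepresentations
  WeierstrassCurve

/-! ## §1 The geometric twist transport `E^{(d)}(F̄) ≃+ E(F̄)` with its sign NAMED -/

/-- **`E^{(d)}(F̄) ≃+ E(F̄)`, equivariant up to the sign `σ√d/√d`** (Silverman *AEC* X.5
Cor. 5.4, X.2 Prop. 2.4): for a Weierstrass equation `W` over a field `F` with `2 ≠ 0` and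
`d ∈ F^*` there is an additive isomorphism `f : E^{(d)}(F̄) ≃+ E(F̄)` with `f(σP) = σ f(P)` when
`σ√d = √d` and `f(σP) = −σ f(P)` when `σ√d = −√d` (`√d = geomSqrt d`): the tree's
`exists_addEquiv_geomPoints_quadraticTwist_signed` (`OpenImageMazurTwistProofs`) with the sign
KEYED on `σ√d` (same construction: `W^{(d)} = W₀^{(d)}`, `W₀ = W.toCharNeTwoNF • W`,
`untwistEquiv`, `untwistEquiv_smul_of_eq[_neg]`, the change of variables `W₀(F̄) ≃+ W(F̄)`).
[cite: SilvermanAEC2009, X.5 Cor. 5.4 and X.2 Prop. 2.4] -/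
theorem exists_addEquiv_geomPoints_quadraticTwist_sign {F : Type u} [Field F] [NeZero (2 : F)]
    (W : WeierstrassCurve F) {d : F} (hd : d ≠ 0) :
    ∃ f : (W.quadraticTwist d).geomPoints ≃+ W.geomPoints,
      ∀ (σ : absoluteGaloisGroup F) (P : (W.quadraticTwist d).geomPoints),
        (absoluteGaloisGroup.toAlgEquiv F σ (geomSqrt d) = geomSqrt d →
          f (σ • P) = σ • f P) ∧
        (absoluteGaloisGroup.toAlgEquiv F σ (geomSqrt d) = -geomSqrt d →
          f (σ • P) = -(σ • f P)) := by
  letI : Invertible (2 : F) := invertibleOfNonzero two_ne_zero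
  set C : VariableChange F := W.toCharNeTwoNF with hC
  set V : WeierstrassCurve F := C • W with hV
  haveI : V.IsCharNeTwoNF := by rw [hV, hC]; infer_instance
  have hVW : W.quadraticTwist d = V.quadraticTwist d := by
    rw [hV, quadraticTwist_smul]
    have h1 : (⟨C.u, d * C.r, 0, 0⟩ : VariableChange F) = 1 := by
      simp only [hC, toCharNeTwoNF, mul_zero]
      rfl
    rw [h1, one_smul]
  let e₁ : (W.quadraticTwist d).geomPoints ≃+ (V.quadraticTwist d).geomPoints :=
    Affine.Point.congrEquiv
      (congrArg (fun Z : WeierstrassCurve F ↦ Z.baseChange (AlgebraicClosure F)) hVW)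
  let e₂ : (V.quadraticTwist d).geomPoints ≃+ V.geomPoints := untwistEquiv V hd
  let e₃ : V.geomPoints ≃+ W.geomPoints :=
    (VariableChange.pointEquivBaseChange W C (AlgebraicClosure F)).symm
  refine ⟨(e₁.trans e₂).trans e₃, fun σ P ↦ ?_⟩
  have h₁ : e₁ (σ • P) = σ • e₁ P :=
    congrEquiv_smul_of_eq hVW (absoluteGaloisGroup.toAlgEquiv F σ) P
  have h₃ : ∀ Q : V.geomPoints, e₃ (σ • Q) = σ • e₃ Q := by
    intro Q
    apply (VariableChange.pointEquivBaseChange W C (AlgebraicClosure F)).injective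
    change VariableChange.pointEquivBaseChange W C (AlgebraicClosure F)
        ((VariableChange.pointEquivBaseChange W C (AlgebraicClosure F)).symm
          (Affine.Point.map ((absoluteGaloisGroup.toAlgEquiv F σ : _) :
            AlgebraicClosure F →ₐ[F] AlgebraicClosure F) Q)) =
      VariableChange.pointEquivBaseChange W C (AlgebraicClosure F)
        (Affine.Point.map ((absoluteGaloisGroup.toAlgEquiv F σ : _) :
            AlgebraicClosure F →ₐ[F] AlgebraicClosure F)
          ((VariableChange.pointEquivBaseChange W C (AlgebraicClosure F)).symm Q))
    rw [AddEquiv.apply_symm_apply, VariableChange.pointEquivBaseChange_map_algEquiv,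
      AddEquiv.apply_symm_apply]
  refine ⟨fun hσ ↦ ?_, fun hσ ↦ ?_⟩
  · simp only [AddEquiv.trans_apply]
    rw [h₁, untwistEquiv_smul_of_eq V hd σ hσ (e₁ P), h₃]
  · simp only [AddEquiv.trans_apply]
    rw [h₁, untwistEquiv_smul_of_eq_neg V hd σ hσ (e₁ P), map_neg, h₃]

/-! ## §2 The local twist transport `E^{(d)}(K̄_E) ≃+ E(K̄_E)` for a curve over `K` and `d ∈ K^*` -/

/-- **The signed twist transport on local points.** For a Weierstrass equation `W` over a field
`K`, `d ∈ K^*`, and a `K`-field `E` with `2 ≠ 0` (a completion `K_v`), there is an additive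
isomorphism `f : E^{(d)}(K̄_E) ≃+ E(K̄_E)` of the tree's local points
(`localPoints (W.quadraticTwist d) E ≃+ localPoints W E`) with, for every `σ ∈ Γ_E`,
`f(σP) = σ f(P)` when `σ√d = √d` and `f(σP) = −σ f(P)` when `σ√d = −√d`, where
`√d = geomSqrt (algebraMap K E d) ∈ K̄_E`: §1 for the base change `W_E` and `d ∈ E`, moved along
`E^{(d)}(K̄_E) = (W^{(d)})_E(Ē)` (`localPointsEquivGeomPoints`, `Γ_E`-equivariant) and
`(W^{(d)})_E = (W_E)^{(d)}` (`map_quadraticTwist`). Silverman *AEC* X.5 Cor. 5.4.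
[cite: SilvermanAEC2009, X.5 Cor. 5.4 and X.2 Prop. 2.4] -/
theorem exists_addEquiv_localPoints_quadraticTwist_sign {K : Type u} [Field K] {E : Type u}
    [Field E] [Algebra K E] [NeZero (2 : E)] (W : WeierstrassCurve K) {d : K} (hd : d ≠ 0) :
    ∃ f : localPoints (W.quadraticTwist d) E ≃+ localPoints W E,
      ∀ (σ : absoluteGaloisGroup E) (P : localPoints (W.quadraticTwist d) E),
        (absoluteGaloisGroup.toAlgEquiv E σ (geomSqrt (algebraMap K E d)) =
            geomSqrt (algebraMap K E d) → f (σ • P) = σ • f P) ∧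
        (absoluteGaloisGroup.toAlgEquiv E σ (geomSqrt (algebraMap K E d)) =
            -geomSqrt (algebraMap K E d) → f (σ • P) = -(σ • f P)) := by
  have hdE : algebraMap K E d ≠ 0 := (map_ne_zero _).mpr hd
  have hmap : (W.quadraticTwist d).baseChange E =
      (W.baseChange E).quadraticTwist (algebraMap K E d) :=
    W.map_quadraticTwist (algebraMap K E) d
  obtain ⟨g, hg⟩ := exists_addEquiv_geomPoints_quadraticTwist_sign (W.baseChange E) hdE
  let e₁ : localPoints (W.quadraticTwist d) E ≃+ geomPoints ((W.quadraticTwist d).baseChange E) :=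
    localPointsEquivGeomPoints (W.quadraticTwist d) E
  let e₂ : geomPoints ((W.quadraticTwist d).baseChange E) ≃+
      geomPoints ((W.baseChange E).quadraticTwist (algebraMap K E d)) :=
    Affine.Point.congrEquiv
      (congrArg (fun Z : WeierstrassCurve E ↦ Z.baseChange (AlgebraicClosure E)) hmap)
  let e₄ : geomPoints (W.baseChange E) ≃+ localPoints W E :=
    (localPointsEquivGeomPoints W E).symm
  refine ⟨((e₁.trans e₂).trans g).trans e₄, fun σ P ↦ ?_⟩
  have h₁ : e₁ (σ • P) = σ • e₁ P := localPointsEquivGeomPoints_smul (W.quadraticTwist d) E σ P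
  have h₂ : ∀ Q : geomPoints ((W.quadraticTwist d).baseChange E), e₂ (σ • Q) = σ • e₂ Q :=
    fun Q ↦ congrEquiv_smul_of_eq hmap (absoluteGaloisGroup.toAlgEquiv E σ) Q
  have h₄ : ∀ R : geomPoints (W.baseChange E), e₄ (σ • R) = σ • e₄ R := by
    intro R
    apply (localPointsEquivGeomPoints W E).injective
    change localPointsEquivGeomPoints W E ((localPointsEquivGeomPoints W E).symm (σ • R)) =
      localPointsEquivGeomPoints W E (σ • (localPointsEquivGeomPoints W E).symm R)
    rw [AddEquiv.apply_symm_apply, localPointsEquivGeomPoints_smul, AddEquiv.apply_symm_apply]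
  refine ⟨fun hσ ↦ ?_, fun hσ ↦ ?_⟩
  · simp only [AddEquiv.trans_apply]
    rw [h₁, h₂, (hg σ _).1 hσ, h₄]
  · simp only [AddEquiv.trans_apply]
    rw [h₁, h₂, (hg σ _).2 hσ, map_neg, h₄]

/-! ## §3 Conjunct (4) of A41 (Cor. V.5.4) follows from conjuncts (2)–(3) for ANY twisted datum -/

/-- **The rational points of a twisted Tate datum** (the content of Silverman *ATAEC* Cor. V.5.4,
derived abstractly). `E` a field, `q ∈ E` with `n ↦ qⁿ` injective on `ℤ` (e.g. `0 < |q| < 1`),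
`t ∈ Ē`, `Ψ : Ē^* → M` a surjective homomorphism onto a `Γ_E`-set `M` with kernel `q^ℤ` and
`σ • Ψ(u) = χ(σ) Ψ(σu)`, `χ(σ) = 1` if `σt = t`, `−1` otherwise: every `Γ_E`-fixed `P ∈ M` is
`Ψ(u)` with `σu = u` for all `σ` fixing `t` and `u · σu ∈ q^ℤ` for all `σ` moving `t`. Proof:
for `σt = t`, `Ψ(σu) = Ψ(u)` gives `σu = u qⁿ`, so `σ^k u = u q^{kn}` for all `k` — conjugates
of the algebraic element `u`, a finite set — so `n = 0`; for `σt ≠ t`, `Ψ(u · σu) = 0`. So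
conjunct (4) of `Silverman1994_thmV53_corV54_tateUniformisation` follows from its (1)–(3) and
`q ≠ 0`, `|q|_v < 1`.
[cite: SilvermanATAEC1994, Ch. V Cor. 5.4 (held copy PDF pp. 409–410)] -/
theorem exists_units_of_forall_smul_eq {E : Type u} [Field E] {M : Type*} [AddCommGroup M]
    [SMul (absoluteGaloisGroup E) M] {q : E} (hq : Function.Injective fun n : ℤ ↦ q ^ n)
    {t : AlgebraicClosure E} {Ψ : Additive (AlgebraicClosure E)ˣ →+ M}
    (hsurj : Function.Surjective Ψ)
    (hker : ∀ u : (AlgebraicClosure E)ˣ, Ψ (Additive.ofMul u) = 0 ↔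
      ∃ n : ℤ, (u : AlgebraicClosure E) = algebraMap E (AlgebraicClosure E) q ^ n)
    (hequiv : ∀ (σ : absoluteGaloisGroup E) (u : (AlgebraicClosure E)ˣ),
      σ • Ψ (Additive.ofMul u) =
        (if absoluteGaloisGroup.toAlgEquiv E σ t = t then (1 : ℤ) else -1) •
          Ψ (Additive.ofMul (Units.map (absoluteGaloisGroup.toAlgEquiv E σ :
            AlgebraicClosure E →* AlgebraicClosure E) u)))
    (P : M) (hP : ∀ σ : absoluteGaloisGroup E, σ • P = P) :
    ∃ u : (AlgebraicClosure E)ˣ,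
      (∀ σ : absoluteGaloisGroup E, absoluteGaloisGroup.toAlgEquiv E σ t = t →
        Units.map (absoluteGaloisGroup.toAlgEquiv E σ :
          AlgebraicClosure E →* AlgebraicClosure E) u = u) ∧
      (∀ σ : absoluteGaloisGroup E, absoluteGaloisGroup.toAlgEquiv E σ t ≠ t →
        ∃ m : ℤ, ((u * Units.map (absoluteGaloisGroup.toAlgEquiv E σ :
          AlgebraicClosure E →* AlgebraicClosure E) u : (AlgebraicClosure E)ˣ) :
            AlgebraicClosure E) = algebraMap E (AlgebraicClosure E) q ^ m) ∧
      Ψ (Additive.ofMul u) = P := by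
  have hq0 : q ≠ 0 := by
    intro h
    have h12 : (fun n : ℤ ↦ q ^ n) 1 = (fun n : ℤ ↦ q ^ n) 2 := by
      simp only [h, zpow_one, zero_zpow _ two_ne_zero]
    exact absurd (hq h12) (by norm_num)
  have hq'0 : algebraMap E (AlgebraicClosure E) q ≠ 0 := (map_ne_zero _).mpr hq0
  obtain ⟨x, hx⟩ := hsurj P
  refine ⟨Additive.toMul x, fun σ hσ ↦ ?_, fun σ hσ ↦ ?_, by rw [ofMul_toMul]; exact hx⟩
  · -- `σ` fixes `t`: `Ψ(σu) = Ψ(u)`, so `σu = u qⁿ`; iterate and count conjugates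
    have hε := hequiv σ (Additive.toMul x)
    rw [if_pos hσ, one_zsmul, ofMul_toMul, hx, hP σ] at hε
    -- `Ψ(σu · u⁻¹) = 0`
    have hzero : Ψ (Additive.ofMul (Units.map (absoluteGaloisGroup.toAlgEquiv E σ :
        AlgebraicClosure E →* AlgebraicClosure E) (Additive.toMul x) * (Additive.toMul x)⁻¹)) =
        0 := by
      rw [ofMul_mul, ofMul_inv, map_add, map_neg, ← hε, ofMul_toMul, hx, add_neg_cancel]
    obtain ⟨n, hn⟩ := (hker _).mp hzero
    rw [Units.val_mul, Units.val_inv_eq_inv_val, Units.coe_map, MonoidHom.coe_coe,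
      mul_inv_eq_iff_eq_mul₀ (Units.ne_zero _)] at hn
    -- `hn : σ u = qⁿ · u`; iterate
    have hiter : ∀ k : ℕ, ((absoluteGaloisGroup.toAlgEquiv E σ) ^ k)
        ((Additive.toMul x : (AlgebraicClosure E)ˣ) : AlgebraicClosure E) =
        algebraMap E (AlgebraicClosure E) q ^ ((k : ℤ) * n) *
          ((Additive.toMul x : (AlgebraicClosure E)ˣ) : AlgebraicClosure E) := by
      intro k
      induction k with
      | zero => simp only [pow_zero, AlgEquiv.one_apply, Nat.cast_zero, zero_mul, zpow_zero,
          one_mul]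
      | succ k ih =>
        rw [pow_succ, AlgEquiv.mul_apply, hn, map_mul, ih, ← map_zpow₀, AlgEquiv.commutes,
          map_zpow₀, ← mul_assoc, ← zpow_add₀ hq'0, Nat.cast_succ]
        congr 2
        ring
    -- all iterates are roots of the minimal polynomial of `u`
    have hmem : ∀ k : ℕ, ((absoluteGaloisGroup.toAlgEquiv E σ) ^ k)
        ((Additive.toMul x : (AlgebraicClosure E)ˣ) : AlgebraicClosure E) ∈
        (minpoly E ((Additive.toMul x : (AlgebraicClosure E)ˣ) : AlgebraicClosure E)).rootSet
          (AlgebraicClosure E) := by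
      intro k
      rw [Polynomial.mem_rootSet]
      refine ⟨minpoly.ne_zero (Algebra.IsIntegral.isIntegral _), ?_⟩
      rw [← minpoly.algEquiv_eq ((absoluteGaloisGroup.toAlgEquiv E σ) ^ k)]
      exact minpoly.aeval E _
    -- hence `n = 0`
    have hn0 : n = 0 := by
      by_contra hn0
      have hinj : Function.Injective fun k : ℕ ↦ ((absoluteGaloisGroup.toAlgEquiv E σ) ^ k)
          ((Additive.toMul x : (AlgebraicClosure E)ˣ) : AlgebraicClosure E) := by
        intro k k' hkk'
        simp only [hiter] at hkk'
        have h1 := mul_right_cancel₀ (Units.ne_zero _) hkk'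
        rw [← map_zpow₀, ← map_zpow₀] at h1
        have h2 : (k : ℤ) * n = (k' : ℤ) * n := hq ((algebraMap E (AlgebraicClosure E)).injective h1)
        exact_mod_cast mul_right_cancel₀ hn0 h2
      exact (Set.infinite_range_of_injective hinj)
        ((Polynomial.rootSet_finite _ _).subset (Set.range_subset_iff.mpr hmem))
    rw [hn0, zpow_zero, one_mul] at hn
    exact Units.ext (by rw [Units.coe_map, MonoidHom.coe_coe]; exact hn)
  · -- `σ` moves `t`: `Ψ(u) = −Ψ(σu)`, so `Ψ(u · σu) = 0`
    have hε := hequiv σ (Additive.toMul x)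
    rw [if_neg hσ, neg_one_zsmul, ofMul_toMul, hx, hP σ] at hε
    have hzero : Ψ (Additive.ofMul (Additive.toMul x * Units.map
        (absoluteGaloisGroup.toAlgEquiv E σ : AlgebraicClosure E →* AlgebraicClosure E)
          (Additive.toMul x))) = 0 := by
      rw [ofMul_mul, map_add, ofMul_toMul, hx, hε, neg_add_cancel]
    exact (hker _).mp hzero

/-! ## §4 A41′ from A41 -/

/-- **Silverman, *ATAEC*, Thm. V.5.3 with Lemma V.5.2 (c) and Cor. V.5.4 under the PRINTED
hypothesis `|j(E)|_v > 1`, from the vendored multiplicative-reduction form A41.** For an elliptic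
curve `E = W` over a number field `K` and a finite place `v` with `1 < v.valuation K W.j`
(`ord_v j(E) < 0`, i.e. `|j(E)|_v > 1`: multiplicative OR additive potentially multiplicative
reduction), granted `Silverman1994_thmV53_corV54_tateUniformisation` (`hU`), there are
`q ∈ K_v`, `q ≠ 0`, `|q|_v < 1`, `t ∈ K̄_v`, `t ≠ 0`, `t² = −c₄/c₆`, `Ψ : K̄_v^* → E(K̄_v)` with
EXACTLY the eight conjuncts of A41 (surjective, kernel `q^ℤ`, `σ • Ψ(u) = ±Ψ(σu)` by `σt = ±t`,
and the `Γ_{K_v}`-fixed points). Proof: a twist `E^{(d)}` is multiplicative at `v`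
(`exists_hasMultiplicativeReductionAt_quadraticTwist_of_one_lt_valuation_j`); A41 gives
`(q, t_d, Ψ_d)` for it; with `f` of `exists_addEquiv_localPoints_quadraticTwist_sign` put
`Ψ = f ∘ Ψ_d`, `t = t_d √d` (`quadraticTwist_c₄/c₆`); (4) by `exists_units_of_forall_smul_eq`.
[cite: SilvermanATAEC1994, Ch. V Lemma 5.2 (c), Thm. 5.3 (a),(b), Cor. 5.4 (held copy PDF pp. 406–410)]
[cite: SilvermanAEC2009, X.5 Cor. 5.4] -/
theorem tateUniformisation_of_one_lt_valuation_j
    (hU : Silverman1994_thmV53_corV54_tateUniformisation.{u})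
    {K : Type u} [Field K] [NumberField K] (W : WeierstrassCurve K) [W.IsElliptic]
    (v : HeightOneSpectrum (𝓞 K)) (hj : 1 < v.valuation K W.j) :
    ∃ (q : v.adicCompletion K) (t : AlgebraicClosure (v.adicCompletion K))
      (Ψ : Additive (AlgebraicClosure (v.adicCompletion K))ˣ →+ localPoints W (v.adicCompletion K)),
      q ≠ 0 ∧ Valued.v q < 1 ∧ t ≠ 0 ∧
      t ^ 2 = algebraMap (v.adicCompletion K) (AlgebraicClosure (v.adicCompletion K))
        (algebraMap K (v.adicCompletion K) (-(W.c₄ / W.c₆))) ∧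
      Function.Surjective Ψ ∧
      (∀ u : (AlgebraicClosure (v.adicCompletion K))ˣ, Ψ (Additive.ofMul u) = 0 ↔
        ∃ n : ℤ, (u : AlgebraicClosure (v.adicCompletion K)) =
          algebraMap (v.adicCompletion K) (AlgebraicClosure (v.adicCompletion K)) q ^ n) ∧
      (∀ (σ : absoluteGaloisGroup (v.adicCompletion K))
          (u : (AlgebraicClosure (v.adicCompletion K))ˣ),
        σ • Ψ (Additive.ofMul u) =
          (if Field.absoluteGaloisGroup.toAlgEquiv (v.adicCompletion K) σ t = t then (1 : ℤ)
            else -1) •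
          Ψ (Additive.ofMul (Units.map
            (Field.absoluteGaloisGroup.toAlgEquiv (v.adicCompletion K) σ :
              AlgebraicClosure (v.adicCompletion K) →* AlgebraicClosure (v.adicCompletion K))
            u))) ∧
      (∀ P : localPoints W (v.adicCompletion K),
        (∀ σ : absoluteGaloisGroup (v.adicCompletion K), σ • P = P) →
        ∃ u : (AlgebraicClosure (v.adicCompletion K))ˣ,
          (∀ σ : absoluteGaloisGroup (v.adicCompletion K),
            Field.absoluteGaloisGroup.toAlgEquiv (v.adicCompletion K) σ t = t →
            Units.map (Field.absoluteGaloisGroup.toAlgEquiv (v.adicCompletion K) σ :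
              AlgebraicClosure (v.adicCompletion K) →* AlgebraicClosure (v.adicCompletion K))
              u = u) ∧
          (∀ σ : absoluteGaloisGroup (v.adicCompletion K),
            Field.absoluteGaloisGroup.toAlgEquiv (v.adicCompletion K) σ t ≠ t →
            ∃ m : ℤ, ((u * Units.map
              (Field.absoluteGaloisGroup.toAlgEquiv (v.adicCompletion K) σ :
                AlgebraicClosure (v.adicCompletion K) →* AlgebraicClosure (v.adicCompletion K))
              u : (AlgebraicClosure (v.adicCompletion K))ˣ) : AlgebraicClosure (v.adicCompletion K)) =
              algebraMap (v.adicCompletion K) (AlgebraicClosure (v.adicCompletion K)) q ^ m) ∧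
          Ψ (Additive.ofMul u) = P) := by
  -- (a) a quadratic twist with multiplicative reduction at `v`
  obtain ⟨d, hd, hmult⟩ :=
    W.exists_hasMultiplicativeReductionAt_quadraticTwist_of_one_lt_valuation_j v hj
  haveI := W.isElliptic_quadraticTwist hd
  -- (b) A41 for the twist (its conjunct (4) is not needed)
  obtain ⟨q, t₁, Ψ₁, hq0, hq1, ht₁0, ht₁sq, hsurj₁, hker₁, hequiv₁, -⟩ := hU (W.quadraticTwist d) v hmult
  -- (c) the signed transport `f : E^{(d)}(K̄_v) ≃+ E(K̄_v)`
  haveI hKv : CharZero (v.adicCompletion K) :=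
    charZero_of_injective_algebraMap (algebraMap K _).injective
  have hL : CharZero (AlgebraicClosure (v.adicCompletion K)) :=
    charZero_of_injective_algebraMap (algebraMap (v.adicCompletion K) _).injective
  haveI : NeZero (2 : v.adicCompletion K) := ⟨two_ne_zero⟩
  obtain ⟨f, hf⟩ :=
    exists_addEquiv_localPoints_quadraticTwist_sign (E := v.adicCompletion K) W hd
  have hs0 : geomSqrt (algebraMap K (v.adicCompletion K) d) ≠ 0 :=
    geomSqrt_ne_zero ((map_ne_zero _).mpr hd)
  have ht₁σ : ∀ σ : absoluteGaloisGroup (v.adicCompletion K),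
      absoluteGaloisGroup.toAlgEquiv _ σ t₁ = t₁ ∨ absoluteGaloisGroup.toAlgEquiv _ σ t₁ = -t₁ := by
    intro σ
    apply sq_eq_sq_iff_eq_or_eq_neg.mp
    rw [← map_pow, ht₁sq, AlgEquiv.commutes]
  have h2 : ∀ x : AlgebraicClosure (v.adicCompletion K), x ≠ 0 → -x ≠ x :=
    fun x hx h ↦ hx (CharZero.neg_eq_self_iff.mp h)
  have ht0 : t₁ * geomSqrt (algebraMap K (v.adicCompletion K) d) ≠ 0 := mul_ne_zero ht₁0 hs0
  -- `t² = −c₄/c₆`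
  have htsq : (t₁ * geomSqrt (algebraMap K (v.adicCompletion K) d)) ^ 2 =
      algebraMap (v.adicCompletion K) (AlgebraicClosure (v.adicCompletion K))
        (algebraMap K (v.adicCompletion K) (-(W.c₄ / W.c₆))) := by
    have key : -((W.quadraticTwist d).c₄ / (W.quadraticTwist d).c₆) * d = -(W.c₄ / W.c₆) := by
      rw [quadraticTwist_c₄, quadraticTwist_c₆]
      by_cases hc : W.c₆ = 0
      · simp [hc]
      · field_simp
    rw [mul_pow, ht₁sq, geomSqrt_sq, ← map_mul, ← map_mul, key]
  -- kernel
  have hkerΨ : ∀ u : (AlgebraicClosure (v.adicCompletion K))ˣ,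
      (f.toAddMonoidHom.comp Ψ₁) (Additive.ofMul u) = 0 ↔
        ∃ n : ℤ, (u : AlgebraicClosure (v.adicCompletion K)) =
          algebraMap (v.adicCompletion K) (AlgebraicClosure (v.adicCompletion K)) q ^ n := by
    intro u
    rw [AddMonoidHom.coe_comp, Function.comp_apply, AddEquiv.coe_toAddMonoidHom,
      AddEquiv.map_eq_zero_iff]
    exact hker₁ u
  -- twisted equivariance: `χ_t = χ_{t₁} · χ_{√d}`
  have hequivΨ : ∀ (σ : absoluteGaloisGroup (v.adicCompletion K))
      (u : (AlgebraicClosure (v.adicCompletion K))ˣ),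
      σ • (f.toAddMonoidHom.comp Ψ₁) (Additive.ofMul u) =
        (if Field.absoluteGaloisGroup.toAlgEquiv (v.adicCompletion K) σ
            (t₁ * geomSqrt (algebraMap K (v.adicCompletion K) d)) =
            t₁ * geomSqrt (algebraMap K (v.adicCompletion K) d) then (1 : ℤ) else -1) •
          (f.toAddMonoidHom.comp Ψ₁) (Additive.ofMul (Units.map
            (Field.absoluteGaloisGroup.toAlgEquiv (v.adicCompletion K) σ :
              AlgebraicClosure (v.adicCompletion K) →* AlgebraicClosure (v.adicCompletion K))
            u)) := by
    intro σ u
    simp only [AddMonoidHom.coe_comp, Function.comp_apply, AddEquiv.coe_toAddMonoidHom]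
    have hε := hequiv₁ σ u
    rcases map_geomSqrt (absoluteGaloisGroup.toAlgEquiv _ σ) (algebraMap K (v.adicCompletion K) d)
      with hs | hs <;> rcases ht₁σ σ with ht | ht
    · rw [if_pos (by rw [map_mul, ht, hs]), one_zsmul, ← (hf σ _).1 hs, hε, if_pos ht, one_zsmul]
    · rw [if_neg (by rw [map_mul, ht, hs, neg_mul]; exact h2 _ ht0), neg_one_zsmul,
        ← (hf σ _).1 hs, hε, if_neg (by rw [ht]; exact h2 _ ht₁0), neg_one_zsmul, map_neg]
    · have h' : σ • f (Ψ₁ (Additive.ofMul u)) = -f (σ • Ψ₁ (Additive.ofMul u)) := by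
        rw [(hf σ _).2 hs, neg_neg]
      rw [if_neg (by rw [map_mul, ht, hs, mul_neg]; exact h2 _ ht0), neg_one_zsmul, h', hε,
        if_pos ht, one_zsmul]
    · have h' : σ • f (Ψ₁ (Additive.ofMul u)) = -f (σ • Ψ₁ (Additive.ofMul u)) := by
        rw [(hf σ _).2 hs, neg_neg]
      rw [if_pos (by rw [map_mul, ht, hs, neg_mul_neg]), one_zsmul, h', hε,
        if_neg (by rw [ht]; exact h2 _ ht₁0), neg_one_zsmul, map_neg, neg_neg]
  -- `n ↦ qⁿ` is injective (`0 < |q|_v < 1`)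
  have hqinj : Function.Injective fun n : ℤ ↦ q ^ n := by
    intro m n hmn
    have h := congrArg Valued.v hmn
    simp only [map_zpow₀] at h
    have hvpos : 0 < Valued.v q := zero_lt_iff.mpr ((Valuation.ne_zero_iff _).mpr hq0)
    exact (zpow_right_strictAnti₀ hvpos hq1).injective h
  exact ⟨q, t₁ * geomSqrt (algebraMap K (v.adicCompletion K) d), f.toAddMonoidHom.comp Ψ₁, hq0,
    hq1, ht0, htsq, f.surjective.comp hsurj₁, hkerΨ, hequivΨ, fun P hP ↦
      exists_units_of_forall_smul_eq hqinj (f.surjective.comp hsurj₁) hkerΨ hequivΨ P hP⟩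

end Summit.BirchSwinnertonDyer.Rank1Residual.AdditivePotMult.TateOfValuationJ

end
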